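import Summits.AtomisticToContinuum.Crystallization.Theorems.ExcessDecayLiouvilleLatticeSums
import Summits.AtomisticToContinuum.Crystallization.Theorems.ExcessDecayLiouvilleHcpLiouvilleDefs

/-!
# `ExcessDecayLiouville.HcpLiouville` (stmt-AtomisticToContinuum-9332), line `Sketch`: the ray integral

Registered helper `ray_integral_eq_secFormAt` of the line `two-level-caccioppoli` (crux `HcpLiouville`,
lead skeleton `Lines/Sketch.lean`), the analytic half of stub `stub_secant_of_box` (box ⇒ ray-secant
coercivity).  For an admissible hcp-like datum `(t, A)` (`Adm₀ A`, `Inner₀ t A`), a field `v` with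
`‖v s‖ ≤ 3/40` on the sites `S = Sites₀ t A` and a finitely supported test field `φ`, the second
variation along the ray `θ ↦ s + θ v s`,

`T(θ) = Σ'_{p : S} Σ'_{q : S} [p ≠ q] Hess₀ ((p − q) + θ (v p − v q)) (φ p − φ q)`,

is continuous on `[0, 1]` and `∫₀¹ T(θ) dθ = secFormAt t A v φ` (the θ-averaged form of the vocabulary
file, whose pair terms are `secHess e d w = ∫₀¹ Hess₀ (e + θ d) w dθ`).

Proof.  Distinct sites are `≥ 23/25` apart (`dist_sites_ge`) and `‖θ (v p − v q)‖ ≤ 3/20`, so the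
displaced bond `e' = (p − q) + θ(v p − v q)` has `‖e'‖ ≥ max (1/2, ‖p − q‖/2)`; hence each pair term is
continuous in `θ` (`V′`, `V″` are continuous off `0`) and bounded by `904·256·‖p − q‖⁻⁸ ‖φ p − φ q‖²`
(`abs_Hess₀_le'`), and `‖φ p − φ q‖² ≤ 2‖φ p‖² + 2‖φ q‖²` vanishes unless `p` or `q` lies in the finite
support.  The dominating family is summable over `S × S` (`summable_inv_pow_eight_sites`, finitely many
rows, symmetry), so `T` is a uniformly convergent series of continuous functions on `[0,1]`
(`continuousOn_tsum`), the iterated sum is the product sum (`Summable.tsum_prod`), and the integral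
commutes with the sum by dominated convergence (`intervalIntegral.hasSum_integral_of_dominated_convergence`).
All `[folklore]`; a `--supports` helper for item stmt-AtomisticToContinuum-9332, nothing here closes an item.
-/

noncomputable section

namespace Summit.AtomisticToContinuum.Crystallization.Theorems.ExcessDecayLiouville

open scoped BigOperators Topology Classical InnerProductSpace
open Literature.MathematicalPhysics.StatisticalMechanics
open Summit.AtomisticToContinuum.Crystallization.Theses.ExcessDecayLiouville
open Summit.AtomisticToContinuum.Crystallization.Theorems.PhononStabilityNegative

local notation "E3" => EuclideanSpace ℝ (Fin 3)

/-! ## Continuity of the force-constant form off the origin -/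

/-- `V′_LJ` is continuous away from `0`. [folklore] -/
private theorem continuousAt_deriv_lj {r : ℝ} (hr : r ≠ 0) : ContinuousAt (deriv lennardJones) r := by
  have hev : (fun y : ℝ => -(y⁻¹) ^ 13 + (y⁻¹) ^ 7) =ᶠ[𝓝 r] deriv lennardJones := by
    filter_upwards [eventually_ne_nhds hr] with y hy using (deriv_lennardJones hy).symm
  have h : ContinuousAt (fun y : ℝ => y⁻¹) r := continuousAt_inv₀ hr
  exact (((h.pow 13).neg).add (h.pow 7)).congr hev

/-- `V″_LJ` is continuous away from `0`. [folklore] -/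
private theorem continuousAt_deriv_deriv_lj {r : ℝ} (hr : r ≠ 0) :
    ContinuousAt (deriv (deriv lennardJones)) r := by
  have hev : (fun y : ℝ => 13 * (y⁻¹) ^ 14 - 7 * (y⁻¹) ^ 8) =ᶠ[𝓝 r] deriv (deriv lennardJones) := by
    filter_upwards [eventually_ne_nhds hr] with y hy using (deriv_deriv_lennardJones hy).symm
  have h : ContinuousAt (fun y : ℝ => y⁻¹) r := continuousAt_inv₀ hr
  exact ((continuousAt_const.mul (h.pow 14)).sub (continuousAt_const.mul (h.pow 8))).congr hev

/-- The force-constant form `e ↦ wᵀK(e)w` is continuous at every `e ≠ 0`. [folklore] -/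
private theorem continuousAt_Hess₀ {e : E3} (he : e ≠ 0) (w : E3) :
    ContinuousAt (fun e' : E3 => Hess₀ e' w) e := by
  have hn : ContinuousAt (fun e' : E3 => ‖e'‖) e := continuous_norm.continuousAt
  have hne : ‖e‖ ≠ 0 := norm_ne_zero_iff.2 he
  have h1 : ContinuousAt (fun e' : E3 => deriv (deriv lennardJones) ‖e'‖) e :=
    ContinuousAt.comp_of_eq (continuousAt_deriv_deriv_lj hne) hn rfl
  have h2 : ContinuousAt (fun e' : E3 => deriv lennardJones ‖e'‖) e :=
    ContinuousAt.comp_of_eq (continuousAt_deriv_lj hne) hn rfl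
  have h3 : ContinuousAt (fun e' : E3 => inner ℝ e' w / ‖e'‖) e :=
    ((continuous_id.inner continuous_const).continuousAt).div hn hne
  unfold Hess₀
  exact (h1.mul (h3.pow 2)).add ((h2.div hn hne).mul (continuousAt_const.sub (h3.pow 2)))

/-- The site set is countable (an image of `Fin 2 × ℤ³`). [folklore] -/
private theorem countable_sites (t : Fin 2 → E3) (A : E3 →L[ℝ] E3) : (Sites₀ t A).Countable := by
  have h : Sites₀ t A ⊆ Set.range (fun x : Fin 2 × ℤ × ℤ × ℤ =>
      t x.1 + A ((x.2.1 : ℝ) • triangularVec₁ 1 + (x.2.2.1 : ℝ) • triangularVec₂ 1 +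
        (x.2.2.2 : ℝ) • layerNormal (2 * Real.sqrt (2 / 3)))) := by
    rintro p ⟨m, z, ⟨i, j, k, rfl⟩, rfl⟩
    exact ⟨(m, i, j, k), rfl⟩
  exact (Set.countable_range _).mono h

/-! ## Pair terms along the ray: lower bound on the bond, upper bound on the term -/

section Sites

variable {t : Fin 2 → E3} {A : E3 →L[ℝ] E3}

/-- For distinct sites `p, q`, `‖v‖ ≤ 3/40` and `θ ∈ [0,1]`, the displaced bond
`e' = (p − q) + θ (v p − v q)` has `‖e'‖ ≥ 1/2` and `|wᵀK(e')w| ≤ 904·256·|p − q|⁻⁸‖w‖²`. [folklore] -/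
private theorem ray_pair_bound (hA : Adm₀ A) (hI : Inner₀ t A) {v : E3 → E3}
    (hv : ∀ s ∈ Sites₀ t A, ‖v s‖ ≤ 3 / 40) {p q : E3} (hp : p ∈ Sites₀ t A) (hq : q ∈ Sites₀ t A)
    (hpq : p ≠ q) {θ : ℝ} (hθ : θ ∈ Set.Icc (0 : ℝ) 1) (w : E3) :
    (1 / 2 : ℝ) ≤ ‖p - q + θ • (v p - v q)‖ ∧
      |Hess₀ (p - q + θ • (v p - v q)) w| ≤ 904 * 256 * ((dist q p)⁻¹ ^ 8 * ‖w‖ ^ 2) := by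
  have hd : 23 / 25 ≤ dist p q := dist_sites_ge hA hI hp hq hpq
  have hdv : ‖θ • (v p - v q)‖ ≤ 3 / 20 := by
    rw [norm_smul, Real.norm_eq_abs, abs_of_nonneg hθ.1]
    have h1 := norm_sub_le (v p) (v q)
    have h2 := hv p hp
    have h3 := hv q hq
    nlinarith [hθ.2, norm_nonneg (v p - v q)]
  have hlow : dist p q - 3 / 20 ≤ ‖p - q + θ • (v p - v q)‖ := by
    have h := norm_sub_norm_le (p - q) (-(θ • (v p - v q)))
    rw [sub_neg_eq_add, norm_neg, ← dist_eq_norm] at h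
    linarith
  have h12 : (1 / 2 : ℝ) ≤ ‖p - q + θ • (v p - v q)‖ := by linarith
  refine ⟨h12, (abs_Hess₀_le' h12 w).trans ?_⟩
  have hpos : 0 < dist p q := by linarith
  have hhalf : dist p q / 2 ≤ ‖p - q + θ • (v p - v q)‖ := by linarith
  have h1 : ‖p - q + θ • (v p - v q)‖⁻¹ ≤ (dist p q / 2)⁻¹ := inv_anti₀ (by positivity) hhalf
  have h2 : ‖p - q + θ • (v p - v q)‖⁻¹ ^ 8 ≤ (dist p q / 2)⁻¹ ^ 8 :=
    pow_le_pow_left₀ (inv_nonneg.2 (norm_nonneg _)) h1 8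
  have h3 : (dist p q / 2)⁻¹ ^ 8 = 256 * (dist q p)⁻¹ ^ 8 := by
    rw [dist_comm q p]
    field_simp
    norm_num
  have hw : 0 ≤ ‖w‖ ^ 2 := sq_nonneg _
  calc 904 * ‖p - q + θ • (v p - v q)‖⁻¹ ^ 8 * ‖w‖ ^ 2
      ≤ 904 * (dist p q / 2)⁻¹ ^ 8 * ‖w‖ ^ 2 := by gcongr
    _ = 904 * 256 * ((dist q p)⁻¹ ^ 8 * ‖w‖ ^ 2) := by rw [h3]; ring

/-! ## The dominating family is summable over `S × S` -/

/-- `(p, q) ↦ [q ≠ p] |q − p|⁻⁸ ‖φ p‖²` is summable over `S × S` for finitely supported `φ`. [folklore] -/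
private theorem summable_kernel_prod (hA : Adm₀ A) (hI : Inner₀ t A) {φ : E3 → E3}
    (hφ : (Function.support φ).Finite) :
    Summable (fun n : Sites₀ t A × Sites₀ t A =>
      (if ((n.2 : Sites₀ t A) : E3) ≠ n.1 then (dist (n.2 : E3) n.1)⁻¹ ^ 8 else 0) * ‖φ n.1‖ ^ 2) := by
  refine (summable_prod_of_nonneg fun n => ?_).2 ⟨fun p => ?_, ?_⟩
  · exact mul_nonneg (by split_ifs <;> positivity) (sq_nonneg _)
  · exact (summable_inv_pow_eight_sites hA hI p.2).mul_right (‖φ p‖ ^ 2)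
  · refine summable_of_ne_finset_zero (s := (finite_support_sites (t := t) (A := A) hφ).toFinset)
      fun p hp => ?_
    have hφp : φ p = 0 := by
      by_contra h
      exact hp ((Set.Finite.mem_toFinset _).2 h)
    simp [hφp]

/-- The dominating family `904·256·[q ≠ p]|q − p|⁻⁸ (2‖φ p‖² + 2‖φ q‖²)` is summable over `S × S`.
[folklore] -/
private theorem summable_bound (hA : Adm₀ A) (hI : Inner₀ t A) {φ : E3 → E3}
    (hφ : (Function.support φ).Finite) :
    Summable (fun n : Sites₀ t A × Sites₀ t A => 904 * 256 *
      ((if ((n.2 : Sites₀ t A) : E3) ≠ n.1 then (dist (n.2 : E3) n.1)⁻¹ ^ 8 else 0) *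
        (2 * ‖φ n.1‖ ^ 2 + 2 * ‖φ n.2‖ ^ 2))) := by
  have h1 := summable_kernel_prod hA hI hφ
  have h2 : Summable (fun n : Sites₀ t A × Sites₀ t A =>
      (if ((n.2 : Sites₀ t A) : E3) ≠ n.1 then (dist (n.2 : E3) n.1)⁻¹ ^ 8 else 0) * ‖φ n.2‖ ^ 2) := by
    refine (Equiv.summable_iff (Equiv.prodComm (Sites₀ t A) (Sites₀ t A))).1 (h1.congr fun n => ?_)
    simp only [Function.comp_apply, Equiv.prodComm_apply, Prod.fst_swap, Prod.snd_swap]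
    rcases eq_or_ne (n.1 : E3) n.2 with h | h
    · simp [h]
    · rw [if_pos h.symm, if_pos h, dist_comm]
  refine ((h1.add h2).mul_left (904 * 256 * 2)).congr fun n => ?_
  ring

/-! ## The ray integral -/

/-- **The ray integral** (registered helper of crux stmt-AtomisticToContinuum-9332, line `Sketch`): along the ray
`θ ↦ s + θ v s` (`‖v‖ ≤ 3/40` on the sites of an admissible hcp-like datum) the second-variation double
sum on a finitely supported test field is continuous on `[0,1]` and its integral over `[0,1]` is the
ray-secant form `secFormAt t A v φ`. [folklore] -/
theorem ray_integral_eq_secFormAt : ∀ (t : Fin 2 → E3) (A : E3 →L[ℝ] E3), Adm₀ A → Inner₀ t A → ∀ v φ : E3 → E3, (∀ s ∈ Sites₀ t A, ‖v s‖ ≤ 3 / 40) → (Function.support φ).Finite → ContinuousOn (fun θ : ℝ => ∑' p : Sites₀ t A, ∑' q : Sites₀ t A, if (p : E3) ≠ q then Hess₀ ((p : E3) - q + θ • (v p - v q)) (φ p - φ q) else 0) (Set.Icc 0 1) ∧ ∫ θ in (0 : ℝ)..1, (∑' p : Sites₀ t A, ∑' q : Sites₀ t A, if (p : E3) ≠ q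 then Hess₀ ((p : E3) - q + θ • (v p - v q)) (φ p - φ q) else 0) = secFormAt t A v φ := by
  intro t A hA hI v φ hv hφ
  -- the family of pair terms on `S × S` and its dominating family
  obtain ⟨F, hF⟩ : ∃ F : Sites₀ t A × Sites₀ t A → ℝ → ℝ, ∀ p q θ, F (p, q) θ =
      if (p : E3) ≠ q then Hess₀ ((p : E3) - q + θ • (v p - v q)) (φ p - φ q) else 0 :=
    ⟨fun n θ => if (n.1 : E3) ≠ n.2 then Hess₀ ((n.1 : E3) - n.2 + θ • (v n.1 - v n.2)) (φ n.1 - φ n.2)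
      else 0, fun _ _ _ => rfl⟩
  obtain ⟨g, hg⟩ : ∃ g : Sites₀ t A × Sites₀ t A → ℝ, ∀ p q, g (p, q) = 904 * 256 *
      ((if (q : E3) ≠ p then (dist (q : E3) p)⁻¹ ^ 8 else 0) * (2 * ‖φ p‖ ^ 2 + 2 * ‖φ q‖ ^ 2)) :=
    ⟨fun n => 904 * 256 * ((if (n.2 : E3) ≠ n.1 then (dist (n.2 : E3) n.1)⁻¹ ^ 8 else 0) *
      (2 * ‖φ n.1‖ ^ 2 + 2 * ‖φ n.2‖ ^ 2)), fun _ _ => rfl⟩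
  have hgs : Summable g := by
    convert summable_bound hA hI hφ using 1
    funext n
    obtain ⟨p, q⟩ := n
    exact hg p q
  have hg0 : ∀ n, 0 ≤ g n := by
    rintro ⟨p, q⟩
    rw [hg]
    exact mul_nonneg (by norm_num) (mul_nonneg (by split_ifs <;> positivity) (by positivity))
  -- domination on `[0,1]`
  have hbound : ∀ n, ∀ θ ∈ Set.Icc (0 : ℝ) 1, ‖F n θ‖ ≤ g n := by
    rintro ⟨p, q⟩ θ hθ
    by_cases hpq : (p : E3) ≠ q
    · rw [hF, hg, if_pos hpq, if_pos (Ne.symm hpq), Real.norm_eq_abs]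
      refine (ray_pair_bound hA hI hv p.2 q.2 hpq hθ (φ p - φ q)).2.trans ?_
      have hw : ‖φ p - φ q‖ ^ 2 ≤ 2 * ‖φ p‖ ^ 2 + 2 * ‖φ q‖ ^ 2 := by
        have h := pow_le_pow_left₀ (norm_nonneg _) (norm_sub_le (φ p) (φ q)) 2
        nlinarith [sq_nonneg (‖φ (p : E3)‖ - ‖φ (q : E3)‖)]
      have ha : 0 ≤ (dist (q : E3) p)⁻¹ ^ 8 := by positivity
      gcongr
    · rw [hF, if_neg hpq, norm_zero]
      exact hg0 (p, q)
  -- continuity of each term on `[0,1]`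
  have hcont : ∀ n, ContinuousOn (F n) (Set.Icc 0 1) := by
    rintro ⟨p, q⟩ θ hθ
    by_cases hpq : (p : E3) ≠ q
    · have hne : (p : E3) - q + θ • (v p - v q) ≠ 0 := by
        have h := (ray_pair_bound hA hI hv p.2 q.2 hpq hθ 0).1
        intro h0
        rw [h0, norm_zero] at h
        norm_num at h
      have h1 : ContinuousAt (fun θ' : ℝ => Hess₀ ((p : E3) - q + θ' • (v p - v q)) (φ p - φ q)) θ :=
        ContinuousAt.comp_of_eq (continuousAt_Hess₀ hne (φ p - φ q))
          ((continuous_const.add (continuous_id.smul continuous_const)).continuousAt) rfl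
      refine (h1.congr (Filter.Eventually.of_forall fun θ' => ?_)).continuousWithinAt
      rw [hF, if_pos hpq]
    · have h0 : F (p, q) = fun _ => 0 := by
        funext θ'
        rw [hF, if_neg hpq]
      rw [h0]
      exact continuousWithinAt_const
  -- summability and the product form of the double sum on `[0,1]`
  have hsum : ∀ θ ∈ Set.Icc (0 : ℝ) 1, Summable fun n => F n θ := fun θ hθ =>
    Summable.of_norm_bounded hgs fun n => hbound n θ hθ
  have hprod : ∀ θ ∈ Set.Icc (0 : ℝ) 1,
      (∑' p : Sites₀ t A, ∑' q : Sites₀ t A,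
        if (p : E3) ≠ q then Hess₀ ((p : E3) - q + θ • (v p - v q)) (φ p - φ q) else 0) =
        ∑' n, F n θ := by
    intro θ hθ
    rw [(hsum θ hθ).tsum_prod]
    simp only [hF]
  -- continuity of the sum
  have hcontT : ContinuousOn (fun θ : ℝ => ∑' p : Sites₀ t A, ∑' q : Sites₀ t A,
      if (p : E3) ≠ q then Hess₀ ((p : E3) - q + θ • (v p - v q)) (φ p - φ q) else 0) (Set.Icc 0 1) :=
    (continuousOn_tsum hcont hgs hbound).congr fun θ hθ => hprod θ hθ
  refine ⟨hcontT, ?_⟩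
  -- dominated convergence
  haveI : Countable (Sites₀ t A) := (countable_sites t A).to_subtype
  have hIoc : Set.uIoc (0 : ℝ) 1 = Set.Ioc 0 1 := Set.uIoc_of_le zero_le_one
  have hHS : HasSum (fun n => ∫ θ in (0 : ℝ)..1, F n θ)
      (∫ θ in (0 : ℝ)..1, ∑' p : Sites₀ t A, ∑' q : Sites₀ t A,
        if (p : E3) ≠ q then Hess₀ ((p : E3) - q + θ • (v p - v q)) (φ p - φ q) else 0) := by
    refine intervalIntegral.hasSum_integral_of_dominated_convergence (fun n _ => g n)
      (fun n => ?_) (fun n => ?_) ?_ ?_ ?_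
    · rw [hIoc]
      exact ((hcont n).mono Set.Ioc_subset_Icc_self).aestronglyMeasurable measurableSet_Ioc
    · refine MeasureTheory.ae_of_all _ fun θ hθ => ?_
      rw [hIoc] at hθ
      exact hbound n θ (Set.Ioc_subset_Icc_self hθ)
    · exact MeasureTheory.ae_of_all _ fun θ _ => hgs
    · exact intervalIntegrable_const
    · refine MeasureTheory.ae_of_all _ fun θ hθ => ?_
      rw [hIoc] at hθ
      rw [hprod θ (Set.Ioc_subset_Icc_self hθ)]
      exact (hsum θ (Set.Ioc_subset_Icc_self hθ)).hasSum
  rw [← hHS.tsum_eq, hHS.summable.tsum_prod]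
  unfold secFormAt
  refine tsum_congr fun p => tsum_congr fun q => ?_
  by_cases hpq : (p : E3) ≠ q
  · simp only [hF, if_pos hpq]
    rfl
  · simp only [hF, if_neg hpq, intervalIntegral.integral_zero]

end Sites

end Summit.AtomisticToContinuum.Crystallization.Theorems.ExcessDecayLiouville

end
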